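import Literature.Topology.FourManifolds.Spin
import Mathlib.Analysis.InnerProductSpace.PiL2
import HarnessLib

/-!
# Lifting a stable framing along a null-homotopy of its Gauss map (Kervaire–Milnor, Lemma 3.5)

Topic `Literature/Topology/FourManifolds` (fact seat
`provefact-Literature.Topology.FourManifolds.HomotopySphere.boundsParallelizable_of_mem_signatureSet`,
Kervaire–Milnor's Lemma 3.4: a connected s-parallelizable manifold with non-vacuous boundary is
parallelizable). Everything here is proved; no named facts.

Kervaire–Milnor, *Groups of homotopy spheres I*, Ann. of Math. 77 (1963), Lemma 3.5 (p. 509):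
"*Let `ξ` be a `k`-dimensional vector space bundle over an `n`-dimensional complex, `k > n`. If
the Whitney sum of `ξ` with a trivial bundle `ε¹` is trivial then `ξ` itself is trivial.* PROOF.
An isomorphism `ξ ⊕ ε¹ ≈ εᵏ⁺¹` gives rise to a bundle map `f` from `ξ` to the bundle `γᵏ` of
oriented `k`-planes in `(k + 1)`-space. Since the base space of `ξ` has dimension `n`, and since
the base space of `γᵏ` is the sphere `Sᵏ`, `k > n`, it follows that `f` is null-homotopic; and
hence that `ξ` is trivial", and the proof of Lemma 3.4: "This follows by a similar argument. The
hypothesis on the manifold guarantees that every map into a sphere of the same dimension is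
null-homotopic."

This file isolates the bundle-theoretic half of that argument for the tree's stable framings
(`Literature.Topology.FourManifolds.HasStableTangentFramingAlong`, `Spin.lean`: `k + 1`
sections `sᵢ = (vᵢ, aᵢ)` of `f*TM ⊕ ℝ`, linearly independent at each point). The coefficient
vector `a = (aᵢ) : S → ℝᵏ⁺¹ ∖ 0` of the projection `f*TM ⊕ ℝ → ℝ` in the frame `(sᵢ)` is the
classifying ("Gauss") map of Kervaire–Milnor's bundle map: `f*TM ≅ a⊥ = â*(TSᵏ)`, `â = a/‖a‖`.

* `hasTangentFramingAlong_of_frame_perp` — the linear algebra: continuous, pointwise linearly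
  independent `c₀, …, c_{k-1} : S → ℝᵏ⁺¹` orthogonal to `a` give the framing `tⱼ = Σᵢ cⱼᵢ vᵢ`
  of `f*TM` (continuity of linear combinations of continuous sections into Mathlib's
  `TangentBundle`, `continuous_sum_smul_along`, by fibrewise linearity of the local
  trivialisations).
* `exists_isometry_lift_of_homotopy` — **the covering homotopy for `O(k+1) → Sᵏ`, discretely**:
  a homotopy `G` of maps `S → Sᵏ` (compact `S`) from the constant `e` to `â` lifts to continuous
  linear isometries `R p` of `ℝᵏ⁺¹` with `R p e = â p`: subdivide `[0, 1]` so finely that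
  consecutive vectors `G (tᵢ, p)`, `G (tᵢ₊₁, p)` are never antipodal
  (`exists_pos_forall_inner_pos`, compactness) and compose the rotations `rot u v = H_v ∘ H_{u+v}`
  (`H_w` the Householder reflection `householder w`), which take `u` to `v` and depend
  continuously on `(u, v)` off `u + v = 0` (Steenrod, *The Topology of Fibre Bundles* (1951),
  §11.3, first covering homotopy theorem — here in the one elementary case needed).
* `hasTangentFramingAlong_of_homotopic_const` — **Lemma 3.5 for stable framings**: if `â` is
  homotopic through unit vectors to a constant map then `f*TM` is framed (`R p e₀, …, R p e_{k-1}`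
  frame `â⊥`).

The other half of Lemma 3.4 — every map from a compact connected manifold with non-empty
boundary to the sphere of the same dimension is null-homotopic — is
`MapsToSphereNullhomotopic.lean`; the assembly is `HomotopySpheresSignatureProofs.lean`.

## References

* M. Kervaire, J. Milnor, *Groups of homotopy spheres I*, Ann. of Math. (2) 77 (1963), 504–537,
  Lemma 3.4 and Lemma 3.5 (p. 509). doi:10.2307/1970128 [KervaireMilnorAnnals1963]
* N. Steenrod, *The Topology of Fibre Bundles*, Princeton (1951), §11.3.
-/

open scoped Manifold ContDiff Topology RealInnerProductSpace
open Set Function Module Bundle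

noncomputable section

namespace Literature.Topology.FourManifolds

/-! ### Householder reflections and the rotation taking `u` to `v` -/

section Householder

variable {F : Type*} [NormedAddCommGroup F] [InnerProductSpace ℝ F]

/-- Local notation: `𝐇[w] x = x - (2⟪w, x⟫/‖w‖²) w` is the **Householder reflection** of `x`
in the hyperplane orthogonal to `w` (the identity for `w = 0`). -/
local notation3 "𝐇[" w "] " x:arg => x - (2 * ⟪w, x⟫ / ‖w‖ ^ 2) • w

/-- Local notation: `𝐑[u, v] x = 𝐇[v] (𝐇[u + v] x)`, the **rotation taking `u` to `v`** (in the
plane of `u`, `v`, for `‖u‖ = ‖v‖`, `u ≠ -v`). -/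
local notation3 "𝐑[" u ", " v "] " x:arg => 𝐇[v] (𝐇[u + v] x)

/-- A Householder reflection preserves inner products. [folklore] -/
theorem inner_householder_householder (w x y : F) : ⟪𝐇[w] x, 𝐇[w] y⟫ = ⟪x, y⟫ := by
  rcases eq_or_ne w 0 with rfl | hw
  · simp
  have hw2 : ‖w‖ ^ 2 ≠ 0 := pow_ne_zero 2 (norm_ne_zero_iff.2 hw)
  simp only [inner_sub_left, inner_sub_right, real_inner_smul_left,
    real_inner_smul_right, real_inner_self_eq_norm_sq]
  field_simp
  rw [real_inner_comm w x]
  ring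

/-- A Householder reflection preserves norms. [folklore] -/
theorem norm_householder (w x : F) : ‖𝐇[w] x‖ = ‖x‖ := by
  have h := inner_householder_householder w x x
  rw [real_inner_self_eq_norm_sq, real_inner_self_eq_norm_sq] at h
  exact (sq_eq_sq₀ (norm_nonneg _) (norm_nonneg _)).1 h

/-- The Householder reflection of `w` maps `-w` to `w`. [folklore] -/
theorem householder_neg_self {w : F} (hw : w ≠ 0) : 𝐇[w] (-w) = w := by
  have hw2 : ‖w‖ ^ 2 ≠ 0 := pow_ne_zero 2 (norm_ne_zero_iff.2 hw)
  simp only [inner_neg_right, real_inner_self_eq_norm_sq]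
  rw [show (2 * -‖w‖ ^ 2 / ‖w‖ ^ 2 : ℝ) = -2 by field_simp]
  module

/-- For `‖u‖ = ‖v‖` and `u + v ≠ 0`, the Householder reflection of `u + v` maps `u` to `-v`.
[folklore] -/
theorem householder_add_apply_left {u v : F} (huv : ‖u‖ = ‖v‖) (hne : u + v ≠ 0) :
    𝐇[u + v] u = -v := by
  have h2 : ‖u + v‖ ^ 2 ≠ 0 := pow_ne_zero 2 (norm_ne_zero_iff.2 hne)
  have key : 2 * ⟪u + v, u⟫ = ‖u + v‖ ^ 2 := by
    rw [norm_add_sq_real, inner_add_left, real_inner_self_eq_norm_sq, real_inner_comm u v, huv]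
    ring
  rw [key, div_self h2, one_smul]
  abel

/-- `𝐑[u, v]` preserves inner products. [folklore] -/
theorem inner_rot_rot (u v x y : F) : ⟪𝐑[u, v] x, 𝐑[u, v] y⟫ = ⟪x, y⟫ := by
  rw [inner_householder_householder, inner_householder_householder]

/-- `𝐑[u, v] u = v` when `‖u‖ = ‖v‖`, `v ≠ 0` and `u + v ≠ 0`. [folklore] -/
theorem rot_apply_left {u v : F} (huv : ‖u‖ = ‖v‖) (hv : v ≠ 0) (hne : u + v ≠ 0) :
    𝐑[u, v] u = v := by
  rw [householder_add_apply_left huv hne, householder_neg_self hv]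

/-- Two vectors with positive inner product do not sum to zero. [folklore] -/
theorem add_ne_zero_of_inner_pos {u v : F} (h : 0 < ⟪u, v⟫) : u + v ≠ 0 := by
  intro huv
  have : v = -u := eq_neg_of_add_eq_zero_right huv
  rw [this, inner_neg_right, real_inner_self_eq_norm_sq] at h
  nlinarith [sq_nonneg ‖u‖]

variable {X : Type*} [TopologicalSpace X]

/-- Continuity of Householder reflections in both arguments, away from `w = 0`. [folklore] -/
theorem continuous_householder {w x : X → F} (hw : Continuous w) (hx : Continuous x)
    (h0 : ∀ p, w p ≠ 0) : Continuous fun p ↦ 𝐇[w p] (x p) := by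
  refine hx.sub (Continuous.smul ?_ hw)
  refine Continuous.div (continuous_const.mul (hw.inner hx)) (hw.norm.pow 2) fun p ↦ ?_
  exact pow_ne_zero 2 (norm_ne_zero_iff.2 (h0 p))

/-- Continuity of `𝐑[u, v] x` in all arguments, away from `v = 0` and `u + v = 0`. [folklore] -/
theorem continuous_rot {u v x : X → F} (hu : Continuous u) (hv : Continuous v)
    (hx : Continuous x) (hv0 : ∀ p, v p ≠ 0) (hne : ∀ p, u p + v p ≠ 0) :
    Continuous fun p ↦ 𝐑[u p, v p] (x p) :=
  continuous_householder hv (continuous_householder (hu.add hv) hx hne) hv0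

/-! ### Chains of rotations along a discretised homotopy -/

/-- **The chain of rotations** `𝐑[uᵢ₋₁, uᵢ] ∘ ⋯ ∘ 𝐑[u₀, u₁]` along a sequence of continuous
families of unit vectors `uⱼ : X → F`, consecutive ones never antipodal: a continuous family of
linear isometries of `F` carrying `u₀ p` to `uᵢ p`. [folklore] -/
theorem exists_rotChain (u : ℕ → X → F) (hu : ∀ j, Continuous (u j))
    (hunit : ∀ j p, ‖u j p‖ = 1) (hne : ∀ j p, u j p + u (j + 1) p ≠ 0) (i : ℕ) :
    ∃ R : X → F → F, (∀ p x y, ⟪R p x, R p y⟫ = ⟪x, y⟫) ∧ (∀ p, R p (u 0 p) = u i p) ∧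
      ∀ x : F, Continuous fun p ↦ R p x := by
  have h0 : ∀ j p, u j p ≠ 0 := fun j p ↦
    norm_ne_zero_iff.1 (by rw [hunit]; exact one_ne_zero)
  induction i with
  | zero => exact ⟨fun _ x ↦ x, fun _ _ _ ↦ rfl, fun _ ↦ rfl, fun _ ↦ continuous_const⟩
  | succ i ih =>
    obtain ⟨R, hRi, hRu, hRc⟩ := ih
    refine ⟨fun p x ↦ 𝐑[u i p, u (i + 1) p] (R p x), fun p x y ↦ ?_, fun p ↦ ?_, fun x ↦ ?_⟩
    · show ⟪𝐑[u i p, u (i + 1) p] (R p x), 𝐑[u i p, u (i + 1) p] (R p y)⟫ = ⟪x, y⟫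
      rw [inner_rot_rot, hRi]
    · show 𝐑[u i p, u (i + 1) p] (R p (u 0 p)) = u (i + 1) p
      rw [hRu]
      exact rot_apply_left ((hunit i p).trans (hunit (i + 1) p).symm) (h0 _ _) (hne i p)
    · exact continuous_rot (hu i) (hu (i + 1)) (hRc x) (h0 (i + 1)) (hne i)

end Householder

/-! ### The discrete covering homotopy for the orthogonal group acting on the sphere -/

section Lift

variable {F : Type*} [NormedAddCommGroup F] [InnerProductSpace ℝ F] {X : Type*}
  [TopologicalSpace X]

/-- **Mesh of a homotopy into the unit sphere.** For a compact `X` and a continuous family of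
unit vectors `H (t, p)`, `t ∈ [0, 1]`, there is `δ > 0` such that `H (s, p)` and `H (t, p)` have
positive inner product (in particular are not antipodal) whenever `|s - t| < δ`. [folklore] -/
theorem exists_pos_forall_inner_pos [CompactSpace X] {H : unitInterval × X → F}
    (hH : Continuous H) (h1 : ∀ q, ‖H q‖ = 1) :
    ∃ δ > (0 : ℝ), ∀ (s t : unitInterval) (p : X), |(s : ℝ) - t| < δ →
      0 < ⟪H (s, p), H (t, p)⟫ := by
  set g : unitInterval × unitInterval × X → ℝ := fun q ↦ ⟪H (q.1, q.2.2), H (q.2.1, q.2.2)⟫ with hg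
  have hgc : Continuous g := by
    refine Continuous.inner (hH.comp (continuous_fst.prodMk (continuous_snd.comp continuous_snd)))
      (hH.comp ((continuous_fst.comp continuous_snd).prodMk (continuous_snd.comp continuous_snd)))
  set K : Set (unitInterval × unitInterval × X) := g ⁻¹' Iic 0 with hK
  have hKc : IsCompact K := (isClosed_Iic.preimage hgc).isCompact
  have hdiag : ∀ q ∈ K, (q.1 : ℝ) ≠ q.2.1 := by
    rintro ⟨s, t, p⟩ hq hst
    have hst' : s = t := Subtype.ext hst
    subst hst'
    have h : g (s, s, p) ≤ 0 := hq
    simp only [hg, real_inner_self_eq_norm_sq, h1] at h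
    norm_num at h
  rcases K.eq_empty_or_nonempty with hKe | hKne
  · refine ⟨1, one_pos, fun s t p _ ↦ ?_⟩
    have : (s, t, p) ∉ K := by rw [hKe]; exact notMem_empty _
    simpa [hK] using this
  · set d : unitInterval × unitInterval × X → ℝ := fun q ↦ |(q.1 : ℝ) - q.2.1| with hd
    have hdc : Continuous d :=
      ((continuous_subtype_val.comp continuous_fst).sub
        (continuous_subtype_val.comp (continuous_fst.comp continuous_snd))).abs
    obtain ⟨q₀, hq₀K, hq₀⟩ := hKc.exists_isMinOn hKne hdc.continuousOn
    refine ⟨d q₀, abs_pos.2 (sub_ne_zero.2 (hdiag q₀ hq₀K)), fun s t p hst ↦ ?_⟩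
    by_contra hle
    have hmem : (s, t, p) ∈ K := not_lt.1 hle
    exact (not_le.2 hst) (hq₀ hmem)

/-- **Discrete covering homotopy** for the action of the orthogonal group on the unit sphere:
if a continuous family of unit vectors `H (t, p)` over a compact `X` starts at a constant vector
`e`, then the end map `p ↦ H (1, p)` lifts to a continuous family of linear isometries `R p`
with `R p e = H (1, p)` — the chain of rotations between consecutive vectors of a subdivision
of the homotopy fine enough that consecutive vectors are never antipodal (Steenrod, *The
Topology of Fibre Bundles* (1951), §11.3, first covering homotopy theorem, in the elementary case
`O(n+1) → Sⁿ`). [folklore] -/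
theorem exists_isometry_lift_of_homotopy [CompactSpace X] {H : unitInterval × X → F}
    (hH : Continuous H) (h1 : ∀ q, ‖H q‖ = 1) {e : F} (h0 : ∀ p, H (0, p) = e) :
    ∃ R : X → F → F, (∀ p x y, ⟪R p x, R p y⟫ = ⟪x, y⟫) ∧ (∀ p, R p e = H (1, p)) ∧
      ∀ x : F, Continuous fun p ↦ R p x := by
  obtain ⟨δ, hδ, hδH⟩ := exists_pos_forall_inner_pos hH h1
  obtain ⟨n, hn⟩ := exists_nat_one_div_lt hδ
  set N : ℕ := n + 1 with hN
  have hNpos : (0 : ℝ) < N := by positivity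
  set t : ℕ → unitInterval := fun i ↦ projIcc (0 : ℝ) 1 zero_le_one (i / N) with ht
  have ht0 : t 0 = 0 := by simp [ht]
  have htN : t N = 1 := by
    simp only [ht, div_self hNpos.ne']
    exact projIcc_right zero_le_one
  have htdist : ∀ i, |(t i : ℝ) - t (i + 1)| < δ := by
    intro i
    refine (abs_projIcc_sub_projIcc zero_le_one).trans_lt ?_
    have : (i : ℝ) / N - (i + 1 : ℕ) / N = -(1 / N) := by
      push_cast; ring
    rw [this, abs_neg, abs_of_pos (by positivity)]
    simpa [hN] using hn
  set u : ℕ → X → F := fun i p ↦ H (t i, p) with hu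
  have huc : ∀ i, Continuous (u i) := fun i ↦ hH.comp (continuous_const.prodMk continuous_id)
  have hunit : ∀ i p, ‖u i p‖ = 1 := fun i p ↦ h1 _
  have hune : ∀ i p, u i p + u (i + 1) p ≠ 0 := fun i p ↦
    add_ne_zero_of_inner_pos (hδH _ _ p (htdist i))
  obtain ⟨R, hRi, hRu, hRc⟩ := exists_rotChain u huc hunit hune N
  refine ⟨R, hRi, fun p ↦ ?_, hRc⟩
  have h := hRu p
  simp only [hu, ht0, htN, h0] at h
  exact h

end Lift

/-! ### Linear combinations of continuous sections of the tangent bundle along a map -/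

section Along

variable {E H : Type*} [NormedAddCommGroup E] [NormedSpace ℝ E] [TopologicalSpace H]
  {I : ModelWithCorners ℝ E H} {M : Type*} [TopologicalSpace M] [ChartedSpace H M]
  [IsManifold I 1 M] {S : Type*} [TopologicalSpace S] {f : S → M}

/-- The sum of two continuous sections of `TM` along `f` is continuous (the local
trivialisations of `TM` are fibrewise linear). [folklore] -/
theorem continuous_add_along {v w : S → E}
    (hv : Continuous fun p ↦ (TotalSpace.mk' E (f p) (v p) : TangentBundle I M))
    (hw : Continuous fun p ↦ (TotalSpace.mk' E (f p) (w p) : TangentBundle I M)) :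
    Continuous fun p ↦ (TotalSpace.mk' E (f p) (v p + w p) : TangentBundle I M) := by
  rw [continuous_iff_continuousAt]
  intro p₀
  have hv₀ := hv.continuousAt (x := p₀)
  have hw₀ := hw.continuousAt (x := p₀)
  rw [FiberBundle.continuousAt_totalSpace] at hv₀ hw₀ ⊢
  obtain ⟨hf, hv₂⟩ := hv₀
  obtain ⟨-, hw₂⟩ := hw₀
  refine ⟨hf, ?_⟩
  set e := trivializationAt E (TangentSpace I) (f p₀) with he
  have hev : ∀ᶠ p in 𝓝 p₀, f p ∈ e.baseSet :=
    hf (e.open_baseSet.mem_nhds (FiberBundle.mem_baseSet_trivializationAt' (f p₀)))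
  refine (hv₂.add hw₂).congr (hev.mono fun p hp ↦ ?_)
  exact ((e.linear ℝ hp).map_add (v p) (w p)).symm

/-- A continuous function times a continuous section of `TM` along `f` is continuous.
[folklore] -/
theorem continuous_smul_along {φ : S → ℝ} {v : S → E} (hφ : Continuous φ)
    (hv : Continuous fun p ↦ (TotalSpace.mk' E (f p) (v p) : TangentBundle I M)) :
    Continuous fun p ↦ (TotalSpace.mk' E (f p) (φ p • v p) : TangentBundle I M) := by
  rw [continuous_iff_continuousAt]
  intro p₀
  have hv₀ := hv.continuousAt (x := p₀)
  rw [FiberBundle.continuousAt_totalSpace] at hv₀ ⊢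
  obtain ⟨hf, hv₂⟩ := hv₀
  refine ⟨hf, ?_⟩
  set e := trivializationAt E (TangentSpace I) (f p₀) with he
  have hev : ∀ᶠ p in 𝓝 p₀, f p ∈ e.baseSet :=
    hf (e.open_baseSet.mem_nhds (FiberBundle.mem_baseSet_trivializationAt' (f p₀)))
  refine ((hφ.continuousAt (x := p₀)).smul hv₂).congr (hev.mono fun p hp ↦ ?_)
  exact ((e.linear ℝ hp).map_smul (φ p) (v p)).symm

/-- The zero section of `TM` along a continuous `f` is continuous. [folklore] -/
theorem continuous_zero_along (hf : Continuous f) :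
    Continuous fun p ↦ (TotalSpace.mk' E (f p) (0 : E) : TangentBundle I M) :=
  (Bundle.Trivialization.continuous_zeroSection ℝ (F := E)
    (E := (TangentSpace I : M → Type _))).comp hf

/-- A finite linear combination, with continuous coefficients, of continuous sections of `TM`
along a continuous `f` is continuous. [folklore] -/
theorem continuous_sum_smul_along (hf : Continuous f) {ι : Type*} (t : Finset ι)
    {φ : ι → S → ℝ} {v : ι → S → E} (hφ : ∀ i ∈ t, Continuous (φ i))
    (hv : ∀ i ∈ t, Continuous fun p ↦ (TotalSpace.mk' E (f p) (v i p) : TangentBundle I M)) :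
    Continuous fun p ↦
      (TotalSpace.mk' E (f p) (∑ i ∈ t, φ i p • v i p) : TangentBundle I M) := by
  classical
  induction t using Finset.induction_on with
  | empty =>
    refine (continuous_zero_along (I := I) hf).congr fun p ↦ ?_
    simp only [Finset.sum_empty]
    rfl
  | insert a t ha ih =>
    simp only [Finset.sum_insert ha]
    refine continuous_add_along (continuous_smul_along (hφ a (by simp)) (hv a (by simp)))
      (ih (fun i hi ↦ hφ i (by simp [hi])) (fun i hi ↦ hv i (by simp [hi])))

end Along

/-! ### Kervaire–Milnor's Lemma 3.5 for stable framings: a framing from a frame of `a⊥` -/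

section Frame

variable {E H : Type*} [NormedAddCommGroup E] [NormedSpace ℝ E] [TopologicalSpace H]
  {I : ModelWithCorners ℝ E H} {M : Type*} [TopologicalSpace M] [ChartedSpace H M]
  [IsManifold I 1 M] {S : Type*} [TopologicalSpace S] {f : S → M}

/-- **The algebra of Kervaire–Milnor's Lemma 3.5** (*Groups of homotopy spheres I* (1963),
p. 509), for stable framings of the tangent bundle along a map `f : S → M`: let
`sᵢ = (vᵢ, aᵢ)`, `i ≤ k = dim M`, be `k + 1` sections of `f*TM ⊕ ℝ` which are linearly
independent at every point (the `vᵢ` continuous into `TM`), and let `c₀, …, c_{k-1}` be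
continuous, pointwise linearly independent vectors of `ℝᵏ⁺¹` orthogonal to the coefficient
vector `a = (aᵢ)ᵢ` of the projection `f*TM ⊕ ℝ → ℝ` (a frame of the bundle `a⊥ ≅ f*TM`).
Then `tⱼ = Σᵢ cⱼᵢ vᵢ` is a framing of `f*TM`. [cite: KervaireMilnorAnnals1963, Lemma 3.5 (p. 509)] -/
theorem hasTangentFramingAlong_of_frame_perp (hf : Continuous f)
    (s : Fin (finrank ℝ E + 1) → S → E × ℝ)
    (hs : ∀ i, Continuous fun p ↦ (TotalSpace.mk' E (f p) (s i p).1 : TangentBundle I M))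
    (hli : ∀ p, LinearIndependent ℝ fun i ↦ s i p)
    (c : Fin (finrank ℝ E) → S → EuclideanSpace ℝ (Fin (finrank ℝ E + 1)))
    (hc : ∀ j, Continuous (c j)) (hcli : ∀ p, LinearIndependent ℝ fun j ↦ c j p)
    (hperp : ∀ p j, ∑ i, c j p i * (s i p).2 = 0) :
    HasTangentFramingAlong I M f := by
  refine ⟨fun j p ↦ ∑ i, c j p i • (s i p).1, fun j ↦ ?_, fun p ↦ ?_⟩
  · exact continuous_sum_smul_along hf Finset.univ
      (fun i _ ↦ (PiLp.continuous_apply (p := 2) (β := fun _ ↦ ℝ) i).comp (hc j))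
      (fun i _ ↦ hs i)
  · refine Fintype.linearIndependent_iff.2 fun g hg j ↦ ?_
    -- the coefficient vector `∑ j, g j • c j p` kills the frame `s · p`, hence vanishes
    have key : ∑ i, (∑ j, g j * c j p i) • s i p = 0 := by
      have h1 : ∑ i, (∑ j, g j * c j p i) • s i p = ∑ j, g j • ∑ i, c j p i • s i p := by
        simp_rw [Finset.sum_smul, mul_smul, Finset.smul_sum]
        rw [Finset.sum_comm]
      rw [h1]
      refine Prod.ext ?_ ?_
      · simpa [Prod.fst_sum, Prod.smul_fst] using hg
      · simp only [Prod.snd_sum, Prod.smul_snd, Prod.snd_zero, smul_eq_mul]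
        simp_rw [hperp p, mul_zero, Finset.sum_const_zero]
    have hcoef : ∀ i, ∑ j, g j * c j p i = 0 :=
      Fintype.linearIndependent_iff.1 (hli p) (fun i ↦ ∑ j, g j * c j p i) key
    have hsum : ∑ j, g j • c j p = 0 := by
      ext i
      simpa [WithLp.ofLp_sum, Finset.sum_apply] using hcoef i
    exact Fintype.linearIndependent_iff.1 (hcli p) g hsum j

/-- **Kervaire–Milnor's Lemma 3.5 for stable framings whose Gauss map is null-homotopic.**
Let `sᵢ = (vᵢ, aᵢ)`, `i ≤ k = dim M`, be a stable framing of `TM` along a map `f` from a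
compact space `S` (continuous into `TM`, resp. continuous, and pointwise linearly independent),
and let `â = a/‖a‖ : S → Sᵏ` be the normalised coefficient vector of the projection
`f*TM ⊕ ℝ → ℝ` ("Gauss map"; `f*TM ≅ â*(TSᵏ)`). If `â` is homotopic, through maps into the
unit sphere, to the constant map at the last basis vector, then `f*TM` admits a framing:
the discrete covering homotopy `exists_isometry_lift_of_homotopy` provides continuous
isometries `R p` with `R p e_k = â p`, and the vectors `R p e_j`, `j < k`, frame `â⊥`
(`hasTangentFramingAlong_of_frame_perp`). This is the mechanism of Kervaire–Milnor's Lemma 3.5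
("an isomorphism `ξ ⊕ ε¹ ≈ εᵏ⁺¹` gives rise to a bundle map `f` from `ξ` to the bundle `γᵏ` of
oriented `k`-planes in `(k+1)`-space … `f` is null-homotopic; and hence `ξ` is trivial").
[cite: KervaireMilnorAnnals1963, Lemma 3.5 (p. 509)] -/
theorem hasTangentFramingAlong_of_homotopic_const [CompactSpace S] (hf : Continuous f)
    (s : Fin (finrank ℝ E + 1) → S → E × ℝ)
    (hs : ∀ i, Continuous fun p ↦ (TotalSpace.mk' E (f p) (s i p).1 : TangentBundle I M))
    (hli : ∀ p, LinearIndependent ℝ fun i ↦ s i p)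
    (G : unitInterval × S → EuclideanSpace ℝ (Fin (finrank ℝ E + 1))) (hG : Continuous G)
    (hG1 : ∀ q, ‖G q‖ = 1)
    (hG0 : ∀ p, G (0, p) = EuclideanSpace.single (Fin.last (finrank ℝ E)) 1)
    (hGa : ∀ p, G (1, p) =
      ‖(WithLp.toLp 2 fun i ↦ (s i p).2 : EuclideanSpace ℝ (Fin (finrank ℝ E + 1)))‖⁻¹ •
        (WithLp.toLp 2 fun i ↦ (s i p).2 : EuclideanSpace ℝ (Fin (finrank ℝ E + 1)))) :
    HasTangentFramingAlong I M f := by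
  obtain ⟨R, hRinner, hRe, hRc⟩ := exists_isometry_lift_of_homotopy hG hG1 hG0
  -- the frame of `â⊥`: the images of the first `k` basis vectors
  refine hasTangentFramingAlong_of_frame_perp hf s hs hli
    (fun j p ↦ R p (EuclideanSpace.single (Fin.castSucc j) 1)) (fun j ↦ hRc _)
    (fun p ↦ ?_) fun p j ↦ ?_
  · -- orthonormal, hence linearly independent
    have hortho : Orthonormal ℝ fun j : Fin (finrank ℝ E) ↦
        R p (EuclideanSpace.single (Fin.castSucc j) 1) := by
      rw [orthonormal_iff_ite]
      intro j j'
      rw [hRinner, orthonormal_iff_ite.1 (EuclideanSpace.orthonormal_single (𝕜 := ℝ)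
        (ι := Fin (finrank ℝ E + 1))) (Fin.castSucc j) (Fin.castSucc j')]
      simp [Fin.castSucc_inj]
    exact hortho.linearIndependent
  · -- `⟪R e_j, a⟫ = ‖a‖ ⟪R e_j, R e_k⟫ = ‖a‖ ⟪e_j, e_k⟫ = 0`
    have hinner : ⟪R p (EuclideanSpace.single (Fin.castSucc j) 1),
        (WithLp.toLp 2 fun i ↦ (s i p).2 : EuclideanSpace ℝ (Fin (finrank ℝ E + 1)))⟫ =
        ∑ i, R p (EuclideanSpace.single (Fin.castSucc j) 1) i * (s i p).2 := by
      simp only [PiLp.inner_apply, RCLike.inner_apply, conj_trivial]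
      exact Finset.sum_congr rfl fun i _ ↦ mul_comm _ _
    rw [← hinner]
    have hperp1 : ⟪R p (EuclideanSpace.single (Fin.castSucc j) 1), G (1, p)⟫ = 0 := by
      rw [← hRe p, hRinner, EuclideanSpace.inner_single_left, PiLp.single_apply]
      simp [(Fin.castSucc_lt_last j).ne]
    rw [hGa p, real_inner_smul_right] at hperp1
    rcases eq_or_ne (WithLp.toLp 2 fun i ↦ (s i p).2 :
        EuclideanSpace ℝ (Fin (finrank ℝ E + 1))) 0 with h0 | h0
    · rw [h0, inner_zero_right]
    · exact (mul_eq_zero.1 hperp1).resolve_left (inv_ne_zero (norm_ne_zero_iff.2 h0))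

end Frame

end Literature.Topology.FourManifolds
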